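import Literature.MathematicalPhysics.QuantumFieldTheory.Balaban1983to89.B9Eq349ConjugatedProjectionChain
import Literature.MathematicalPhysics.QuantumFieldTheory.Balaban1983to89.B9Eq3126GreenLetters
import Literature.MathematicalPhysics.QuantumFieldTheory.Balaban1983to89.B9Eq3124GaugeModes

/-!
# `Balaban1983to89.B9Eq325ProjectionDivergenceEnergyBound` — T. Bałaban, *Propagators for lattice gauge theories in a background field*, Commun.
# Math. Phys. **99** (1985) 389–434 [Balaban1985BackgroundPropagators] (3.21)∕(3.25) p. 394, (3.26) p. 395, (3.49) p. 399, Thm 3.11 p. 416: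
# **THE COMPLEMENTARY PROJECTION OF THE DIVERGENCE IS A BOUNDED OPERATOR — `‖(1 − R(U))(D*_U u)‖ ≤ C_P‖u‖` and `‖D_U((1 − R(U))s)‖ ≤ C_P‖s‖` with
# `C_P = C_E√C_E·C_Q²∕κ₁` — BY ENERGY ALONE**: `1 − R(U) = P(U) = G′Q̃′†·c·Q̃′G′` ((3.25), `c = (Q̃′G′²Q̃′†)⁻¹`), and `‖G′(D*_U u)‖, ‖D_U(G′v)‖ ≤ √C_E·‖·‖`
# because ONE covariant derivative is absorbed by the energy form of `G′ = (Δ′_{a′}(U))⁻¹` (`‖D_Uf‖² ≤ re⟪f, Δ′_{a′}(U)f⟫`); the letter `C_P` of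
# `B9Eq326ConjugatedDeltaALetters` (the Combes–Thomas bound for `G₁ = Δ_a⁻¹` with the projected square `D_UR(U)D*_U`) — a letter of `G′`'s value
# `C_E`, `Q̃′`'s size `C_Q` and Thm 3.11's third constant `κ₁` ONLY: no `η`, no volume, no gradient row

statement-level skeleton of published theorems with citation tags; proofs where landed; nothing here is a claim about the Yang–Mills mass gap

CITATION HEADER (lean-in-tree rule).  Audit cell `pub-balaban`, sub-cell `t4`, BINDER row NE9; filed by NE9 formalisation-swarm leaf prover 03
(`b2b-balaban-t4-ne9-formalise-leaf-03`, gen 75).  Imports ne9-leaf-06's `B9Eq349ConjugatedProjectionChain` (`one_sub_RofU_apply_eq`: `f − R(U)f = A(Tf)`,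
`A = G′Q̃′†`, `Tf = c(Q̃′(G′f))`; `sq_norm_covDerivL2K_le_re_inner`: `‖D_Uf‖² ≤ re⟪f, Δ′_{a′}(U)f⟫`), the NE9 owner's `B9Eq3126GreenLetters` (`norm_greenK_le`;
through it `B9Eq373DerivativeRemainderL2.norm_adjoint_apply_le`) and `B9Eq3124GaugeModes` (`greenK_isSymmetric`).  Sources READ first-hand
(`paper:balaban1985-cmp99-background-propagators`, journal page = PDF page + 388): p. 394 (3.21) *«R = R(U) is an orthogonal projection … onto the subspace
R = Δ_U N(Q′)»*, (3.25) *«Rf = (I − G′Q′*(Q′G′²Q′*)⁻¹Q′G′)f, where G′ = G′(U) = (Δ′_a)⁻¹»*, p. 395 (3.26), p. 399 (3.49) (print's kernels of `P`, `DP`), p. 416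
Thm 3.11 *«the operators Δ′_a, G′, Q′G′²Q′*, Δ_a, G are positive, uniformly bounded from below»* (the source of `κ₁`).  Print bounds the KERNELS of `P`,
`DP` by the random walk; the operator-norm bound here is [folklore] energy bookkeeping and asserts nothing of print's.

WHY THIS FILE (cell context; PRE-INTENT [NE9LEAF03-G75-PREINTENT-1]).  `B9Eq326ConjugatedDeltaALetters.coercive_k_projected` (this lineage) keeps HALF of
the conjugated projected square `D_UR(U)D*_U` of `Δ_a(U)` — enough for Combes–Thomas on `G₁ = Δ_a⁻¹` — PROVIDED the complementary part `(1 − R(U))D*_U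
= P(U)D*_U` is a BOUNDED operator `E → S` (bonds → sites) although `D*_U` itself is of size `η⁻¹`.  It is: `P(U)D*_U u = G′(Q̃′†(c(Q̃′(G′(D*_U u)))))`
and `G′D*_U = (D_UG′)†` is bounded by `√‖G′‖` — the one derivative is paid by the energy of `G′`.  The same computation bounds `D_UP(U)` (the `DPD*`
term the owner's `L∞` bootstrap meets, plan v11 FIND-1).

WHAT IS PROVED (sorry-free; proof lane — no `def`; [folklore] Hilbert-space bookkeeping BY NAME).  For the chain's one-step objects on `fineP L m`:
`G′ = GpOfU L m φ η U a′ hpos′`, `Q̃′ = (WL2.linearEquiv … c₁).symm ∘ QprimeW L m φ U`, `c = greenK (Q̃′G′G′Q̃′†) (QGGQ_pos …)`, `R(U) = RofU L m φ η U`,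
`D_U = covDerivL2K ℂ c₀ η⁻¹ R(U)`, `D*_U = covDivL2K ℂ c₀ η⁻¹ R(U⁻¹)`, mutually adjoint transporters `hRS`, `a′ ≥ 0`; LETTERS: the value `‖G′v‖ ≤ C_E‖v‖`
(`hE`), the size `‖Q̃′s‖ ≤ C_Q‖s‖` (`hQ`), the FORM certificate `κ₁‖ψ‖² ≤ re⟪ψ, Q̃′G′²Q̃′†ψ⟫` (`hκ`, Thm 3.11's third operator — KAPPA1).
* §1 **`norm_covDerivL2K_GpOfU_le`** (`‖D_U(G′v)‖ ≤ √C_E‖v‖`), `GpOfU_isSymmetric`, **`norm_GpOfU_covDivL2K_le`** (`‖G′(D*_U u)‖ ≤ √C_E‖u‖`).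
* §2 `norm_QGGQinv_le` (`‖cψ‖ ≤ κ₁⁻¹‖ψ‖`), `norm_adjoint_Qt_le` (`‖Q̃′†g‖ ≤ C_Q‖g‖`).
* §3 **`norm_one_sub_RofU_covDivL2K_le`** — `‖D*_U u − R(U)(D*_U u)‖ ≤ (C_E√C_E·C_Q²∕κ₁)‖u‖`; **`norm_covDerivL2K_one_sub_RofU_le`** —
  `‖D_U(s − R(U)s)‖ ≤ (C_E√C_E·C_Q²∕κ₁)‖s‖`.
HONEST SCOPE.  Energy bookkeeping; `C_E`, `C_Q`, `κ₁` displayed (their level-free suppliers: `B9Thm311SitePrimeFormCoerciveTowerCanonical` + `norm_greenK_le`,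
ne9-leaf-02's flat count + deviation, KAPPA1's files); nothing of [B9] Thm 3.1∕3.3∕3.11 or (3.49) asserted or valued; «NE9 ⇐ the named binders»; NE9 NOT
PRINTED ∕ NOT PROVED; row WALLED ON A MODEL (O-NE9-1; #5 UNRULED); spine PROVED 0∕9; rung (B)+1 on a finite T⁴ — NOT infinite volume, NOT mass gap, NOT
BetaPertH, NOT Clay.  HONEST DEPENDENCY: continuum YM on T⁴ ⇐ BetaPertH ∧ nine spine estimates (0/9 proved); BetaPertH ⇐ (D1) ∧ (D4) ∧ CAP+tail.  NEW file;
nothing modified.  Net new unproved facts: 0.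
-/

noncomputable section

open scoped InnerProductSpace ComplexConjugate

namespace Literature.MathematicalPhysics.QuantumFieldTheory.Balaban1983to89.B9Eq325ProjectionDivergenceEnergyBound

open B4Sect5Torus (TSite)
open B9SectCLatticeCarrier (Bond)
open B9Eq311L2Pairing (WL2)
open B9Eq319QprimeTorus (fineP)
open B11Eq103H1Complex (SiteL2K BondL2K greenK apply_greenK covDerivL2K covDivL2K adjoint_covDerivL2K)
open B9Eq310HessianOperator (adTransportW)
open B9Eq326OperatorAssembly (QprimeW RofU)
open B9Eq3119DeltaPiCarrier (laplacePrimeA GpOfU)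
open B9Eq325ProjFormula (laplacePrimeA_isSymmetric QGGQ_pos)
open B9Eq349ConjugatedProjectionChain (one_sub_RofU_apply_eq sq_norm_covDerivL2K_le_re_inner)
open B9Eq3126GreenLetters (norm_greenK_le)
open B9Eq3124GaugeModes (greenK_isSymmetric)
open B9Eq373DerivativeRemainderL2 (norm_adjoint_apply_le)

variable {d : ℕ} (L : ℕ) [NeZero L] (m : Fin d → ℕ) {𝔸 : Type*} [Ring 𝔸] [Algebra ℂ 𝔸]
  {W : Type*} [NormedAddCommGroup W] [InnerProductSpace ℂ W] [FiniteDimensional ℂ W] (φ : W ≃ₗ[ℂ] 𝔸) (c₀ : ℝ) [Fact (0 < c₀)]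
  (η : ℝ) (U : Bond d (fineP L m) → 𝔸ˣ) (c₁ : ℝ) [Fact (0 < c₁)] (a' : ℝ)
  (hRS : ∀ (b : Bond d (fineP L m)) (v u : W), ⟪adTransportW φ U b v, u⟫_ℂ = ⟪v, adTransportW φ (fun b => (U b)⁻¹) b u⟫_ℂ)
  (hpos' : ∀ x : SiteL2K ℂ d (fineP L m) c₀ W, x ≠ 0 → 0 < RCLike.re ⟪x, laplacePrimeA L m φ η U a' (c₁ := c₁) x⟫_ℂ)

/-- `‖x‖² ≤ c‖x‖r` with `0 ≤ c, r` gives `‖x‖ ≤ cr`. [folklore] [cite: Balaban1985BackgroundPropagators, (3.11) p.392] -/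
private theorem norm_le_of_sq_le_mul' {V : Type*} [NormedAddCommGroup V] {x : V} {c r : ℝ} (hc : 0 ≤ c) (hr : 0 ≤ r)
    (h : ‖x‖ ^ 2 ≤ c * ‖x‖ * r) : ‖x‖ ≤ c * r := by
  by_cases hx : x = 0
  · simp [hx]; positivity
  · have hxpos : 0 < ‖x‖ := norm_pos_iff.mpr hx
    nlinarith [h, hxpos]

/-- `conj η⁻¹ = η⁻¹`. [folklore] [cite: Balaban1985BackgroundPropagators, (3.3) p.391] -/
private theorem conj_inv_eta' : (starRingEnd ℂ) ((η : ℂ))⁻¹ = ((η : ℂ))⁻¹ := by rw [map_inv₀, Complex.conj_ofReal]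

/-! ## §1 One covariant derivative is absorbed by the energy of `G′` -/

include hRS in
/-- **`‖D_U(G′v)‖ ≤ √C_E‖v‖`**: `‖D_U(G′v)‖² ≤ re⟪G′v, Δ′_{a′}(G′v)⟫ = re⟪G′v, v⟫ ≤ C_E‖v‖²`. [folklore]
[cite: Balaban1985BackgroundPropagators, (3.24)–(3.25) p.394, Thm 3.11 p.416] -/
theorem norm_covDerivL2K_GpOfU_le (ha' : 0 ≤ a') {CE : ℝ} (hCE : 0 ≤ CE)
    (hE : ∀ v, ‖GpOfU L m φ η U a' (c₁ := c₁) hpos' v‖ ≤ CE * ‖v‖) (v : SiteL2K ℂ d (fineP L m) c₀ W) :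
    ‖covDerivL2K ℂ c₀ ((η : ℂ))⁻¹ (adTransportW φ U) (GpOfU L m φ η U a' (c₁ := c₁) hpos' v)‖ ≤ Real.sqrt CE * ‖v‖ := by
  have h1 := sq_norm_covDerivL2K_le_re_inner L m φ c₀ η U c₁ a' hRS ha' (GpOfU L m φ η U a' (c₁ := c₁) hpos' v)
  have h2 : RCLike.re ⟪GpOfU L m φ η U a' (c₁ := c₁) hpos' v, laplacePrimeA L m φ η U a' (c₁ := c₁) (GpOfU L m φ η U a' (c₁ := c₁) hpos' v)⟫_ℂ ≤
      CE * ‖v‖ ^ 2 := by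
    unfold GpOfU
    rw [apply_greenK hpos']
    calc RCLike.re ⟪greenK _ hpos' v, v⟫_ℂ ≤ ‖greenK _ hpos' v‖ * ‖v‖ := (RCLike.re_le_norm _).trans (norm_inner_le_norm _ _)
      _ ≤ CE * ‖v‖ * ‖v‖ := mul_le_mul_of_nonneg_right (hE v) (norm_nonneg _)
      _ = CE * ‖v‖ ^ 2 := by ring
  have h3 : ‖covDerivL2K ℂ c₀ ((η : ℂ))⁻¹ (adTransportW φ U) (GpOfU L m φ η U a' (c₁ := c₁) hpos' v)‖ ^ 2 ≤ (Real.sqrt CE * ‖v‖) ^ 2 := by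
    rw [mul_pow, Real.sq_sqrt hCE]; linarith
  have hb : 0 ≤ Real.sqrt CE * ‖v‖ := by positivity
  nlinarith [h3, hb, norm_nonneg (covDerivL2K ℂ c₀ ((η : ℂ))⁻¹ (adTransportW φ U) (GpOfU L m φ η U a' (c₁ := c₁) hpos' v))]

include hRS in
/-- **`G′(U)` is symmetric** (the inverse of the symmetric `Δ′_{a′}(U)`). [cite: Balaban1985BackgroundPropagators, (3.25) p.394] -/
theorem GpOfU_isSymmetric : (GpOfU L m φ η U a' (c₁ := c₁) hpos').IsSymmetric :=
  greenK_isSymmetric hpos' (laplacePrimeA_isSymmetric L m φ c₀ η U c₁ a' hRS)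

include hRS in
/-- **`‖G′(D*_U u)‖ ≤ √C_E‖u‖`** — the divergence costs NOTHING against `G′` in `L²`: `‖G′D*_Uu‖² = re⟪u, D_U(G′(G′D*_Uu))⟫ ≤ ‖u‖·√C_E·‖G′D*_Uu‖`
(`G′` symmetric, `D*_U = D_U†`, §1's first bound). [folklore] [cite: Balaban1985BackgroundPropagators, (3.8) p.392, (3.25) p.394, Thm 3.11 p.416] -/
theorem norm_GpOfU_covDivL2K_le (ha' : 0 ≤ a') {CE : ℝ} (hCE : 0 ≤ CE)
    (hE : ∀ v, ‖GpOfU L m φ η U a' (c₁ := c₁) hpos' v‖ ≤ CE * ‖v‖) (u : BondL2K ℂ d (fineP L m) c₀ W) :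
    ‖GpOfU L m φ η U a' (c₁ := c₁) hpos' (covDivL2K ℂ c₀ ((η : ℂ))⁻¹ (adTransportW φ fun b => (U b)⁻¹) u)‖ ≤ Real.sqrt CE * ‖u‖ := by
  set w := GpOfU L m φ η U a' (c₁ := c₁) hpos' (covDivL2K ℂ c₀ ((η : ℂ))⁻¹ (adTransportW φ fun b => (U b)⁻¹) u) with hw
  have hadj : covDivL2K ℂ c₀ ((η : ℂ))⁻¹ (adTransportW φ fun b => (U b)⁻¹) =
      LinearMap.adjoint (covDerivL2K ℂ c₀ ((η : ℂ))⁻¹ (adTransportW φ U)) := (adjoint_covDerivL2K _ (conj_inv_eta' η) _ _ hRS).symm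
  have e : ‖w‖ ^ 2 = RCLike.re ⟪u, covDerivL2K ℂ c₀ ((η : ℂ))⁻¹ (adTransportW φ U) (GpOfU L m φ η U a' (c₁ := c₁) hpos' w)⟫_ℂ := by
    rw [← inner_self_eq_norm_sq (𝕜 := ℂ), hw]
    conv_lhs => rw [GpOfU_isSymmetric L m φ c₀ η U c₁ a' hRS hpos']
    rw [hadj, LinearMap.adjoint_inner_left]
  have h1 : ‖w‖ ^ 2 ≤ ‖u‖ * (Real.sqrt CE * ‖w‖) := by
    rw [e]
    exact ((RCLike.re_le_norm _).trans (norm_inner_le_norm _ _)).trans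
      (mul_le_mul_of_nonneg_left (norm_covDerivL2K_GpOfU_le L m φ c₀ η U c₁ a' hRS hpos' ha' hCE hE w) (norm_nonneg _))
  have := norm_le_of_sq_le_mul' (x := w) (c := Real.sqrt CE) (r := ‖u‖) (Real.sqrt_nonneg _) (norm_nonneg _) (by nlinarith [h1])
  exact this

/-! ## §2 The sizes of `c = (Q̃′G′²Q̃′†)⁻¹` and of `Q̃′†` -/

include hRS in
/-- **`‖cψ‖ ≤ κ₁⁻¹‖ψ‖`** from the FORM certificate of Thm 3.11's third operator (`norm_greenK_le`). [cite: Balaban1985BackgroundPropagators, Thm 3.11 p.416, Thm 3.2 (3.48) p.398] -/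
theorem norm_QGGQinv_le {κ₁ : ℝ} (hκ₁ : 0 < κ₁)
    (hκ : ∀ ψ : SiteL2K ℂ d m c₁ W, κ₁ * ‖ψ‖ ^ 2 ≤ RCLike.re ⟪ψ,
      (((WL2.linearEquiv ℂ ℂ (fun _ : TSite d m => c₁)).symm.toLinearMap ∘ₗ QprimeW L m φ U (c₀ := c₀)) ∘ₗ
        GpOfU L m φ η U a' (c₁ := c₁) hpos' ∘ₗ GpOfU L m φ η U a' (c₁ := c₁) hpos' ∘ₗ
        LinearMap.adjoint ((WL2.linearEquiv ℂ ℂ (fun _ : TSite d m => c₁)).symm.toLinearMap ∘ₗ QprimeW L m φ U (c₀ := c₀))) ψ⟫_ℂ)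
    (ψ : SiteL2K ℂ d m c₁ W) :
    ‖greenK _ (QGGQ_pos L m φ c₀ η U c₁ a' hRS hpos') ψ‖ ≤ κ₁⁻¹ * ‖ψ‖ :=
  norm_greenK_le hκ₁ hκ _ ψ

omit [Fact (0 < c₁)] [NeZero L] in
/-- **`‖Q̃′†g‖ ≤ C_Q‖g‖`** from `‖Q̃′s‖ ≤ C_Q‖s‖`. [folklore] [cite: Balaban1985BackgroundPropagators, (3.19) p.393] -/
theorem norm_adjoint_Qt_le [NeZero L] [Fact (0 < c₁)] {CQ : ℝ} (hCQ : 0 ≤ CQ)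
    (hQ : ∀ s, ‖((WL2.linearEquiv ℂ ℂ (fun _ : TSite d m => c₁)).symm.toLinearMap ∘ₗ QprimeW L m φ U (c₀ := c₀)) s‖ ≤ CQ * ‖s‖)
    (g : SiteL2K ℂ d m c₁ W) :
    ‖LinearMap.adjoint ((WL2.linearEquiv ℂ ℂ (fun _ : TSite d m => c₁)).symm.toLinearMap ∘ₗ QprimeW L m φ U (c₀ := c₀)) g‖ ≤ CQ * ‖g‖ :=
  norm_adjoint_apply_le _ hCQ hQ g

/-! ## §3 The letter `C_P`: the complementary projection of the divergence, and the derivative of the complementary projection -/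

include hRS in
/-- **`‖D*_U u − R(U)(D*_U u)‖ ≤ (C_E√C_E·C_Q²∕κ₁)·‖u‖` — THE LETTER `C_P` OF `B9Eq326ConjugatedDeltaALetters` AT THE CHAIN**:
`(1 − R(U))(D*_Uu) = G′(Q̃′†(c(Q̃′(G′(D*_Uu)))))` (`one_sub_RofU_apply_eq`), then `‖G′‖ ≤ C_E`, `‖Q̃′†‖ ≤ C_Q`, `‖c‖ ≤ κ₁⁻¹`, `‖Q̃′‖ ≤ C_Q` and §1's
`‖G′(D*_Uu)‖ ≤ √C_E‖u‖` — no `η`, no volume. [folklore] [cite: Balaban1985BackgroundPropagators, (3.21) p.394, (3.25) p.394, (3.26) p.395, Thm 3.11 p.416] -/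
theorem norm_one_sub_RofU_covDivL2K_le (ha' : 0 ≤ a') {CE CQ κ₁ : ℝ} (hCE : 0 ≤ CE) (hCQ : 0 ≤ CQ) (hκ₁ : 0 < κ₁)
    (hE : ∀ v, ‖GpOfU L m φ η U a' (c₁ := c₁) hpos' v‖ ≤ CE * ‖v‖)
    (hQ : ∀ s, ‖((WL2.linearEquiv ℂ ℂ (fun _ : TSite d m => c₁)).symm.toLinearMap ∘ₗ QprimeW L m φ U (c₀ := c₀)) s‖ ≤ CQ * ‖s‖)
    (hκ : ∀ ψ : SiteL2K ℂ d m c₁ W, κ₁ * ‖ψ‖ ^ 2 ≤ RCLike.re ⟪ψ,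
      (((WL2.linearEquiv ℂ ℂ (fun _ : TSite d m => c₁)).symm.toLinearMap ∘ₗ QprimeW L m φ U (c₀ := c₀)) ∘ₗ
        GpOfU L m φ η U a' (c₁ := c₁) hpos' ∘ₗ GpOfU L m φ η U a' (c₁ := c₁) hpos' ∘ₗ
        LinearMap.adjoint ((WL2.linearEquiv ℂ ℂ (fun _ : TSite d m => c₁)).symm.toLinearMap ∘ₗ QprimeW L m φ U (c₀ := c₀))) ψ⟫_ℂ)
    (u : BondL2K ℂ d (fineP L m) c₀ W) :
    ‖covDivL2K ℂ c₀ ((η : ℂ))⁻¹ (adTransportW φ fun b => (U b)⁻¹) u -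
        RofU L m φ η U (c₀ := c₀) (covDivL2K ℂ c₀ ((η : ℂ))⁻¹ (adTransportW φ fun b => (U b)⁻¹) u)‖ ≤
      CE * Real.sqrt CE * CQ ^ 2 / κ₁ * ‖u‖ := by
  rw [one_sub_RofU_apply_eq L m φ c₀ η U c₁ a' hRS hpos']
  simp only [LinearMap.comp_apply]
  set s := covDivL2K ℂ c₀ ((η : ℂ))⁻¹ (adTransportW φ fun b => (U b)⁻¹) u
  have h4 := norm_GpOfU_covDivL2K_le L m φ c₀ η U c₁ a' hRS hpos' ha' hCE hE u
  have h3 := (hQ (GpOfU L m φ η U a' (c₁ := c₁) hpos' s)).trans (mul_le_mul_of_nonneg_left h4 hCQ)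
  have h2 := (norm_QGGQinv_le L m φ c₀ η U c₁ a' hRS hpos' hκ₁ hκ _).trans (mul_le_mul_of_nonneg_left h3 (inv_nonneg.2 hκ₁.le))
  have h1 := (norm_adjoint_Qt_le L m φ c₀ U c₁ hCQ hQ _).trans (mul_le_mul_of_nonneg_left h2 hCQ)
  have h0 := (hE _).trans (mul_le_mul_of_nonneg_left h1 hCE)
  refine h0.trans (le_of_eq ?_)
  field_simp

include hRS in
/-- **`‖D_U(s − R(U)s)‖ ≤ (C_E√C_E·C_Q²∕κ₁)·‖s‖` — the derivative of the complementary projection `D_UP(U)` is bounded** (the adjoint reading: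
`D_U(P(U)s) = D_U(G′(Q̃′†(c(Q̃′(G′s)))))` and §1's `‖D_U(G′v)‖ ≤ √C_E‖v‖`); the operator the `DPD*u` term of the bond bootstrap meets. [folklore]
[cite: Balaban1985BackgroundPropagators, (3.25) p.394, (3.26) p.395, (3.49) p.399, Thm 3.11 p.416] -/
theorem norm_covDerivL2K_one_sub_RofU_le (ha' : 0 ≤ a') {CE CQ κ₁ : ℝ} (hCE : 0 ≤ CE) (hCQ : 0 ≤ CQ) (hκ₁ : 0 < κ₁)
    (hE : ∀ v, ‖GpOfU L m φ η U a' (c₁ := c₁) hpos' v‖ ≤ CE * ‖v‖)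
    (hQ : ∀ s, ‖((WL2.linearEquiv ℂ ℂ (fun _ : TSite d m => c₁)).symm.toLinearMap ∘ₗ QprimeW L m φ U (c₀ := c₀)) s‖ ≤ CQ * ‖s‖)
    (hκ : ∀ ψ : SiteL2K ℂ d m c₁ W, κ₁ * ‖ψ‖ ^ 2 ≤ RCLike.re ⟪ψ,
      (((WL2.linearEquiv ℂ ℂ (fun _ : TSite d m => c₁)).symm.toLinearMap ∘ₗ QprimeW L m φ U (c₀ := c₀)) ∘ₗ
        GpOfU L m φ η U a' (c₁ := c₁) hpos' ∘ₗ GpOfU L m φ η U a' (c₁ := c₁) hpos' ∘ₗ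
        LinearMap.adjoint ((WL2.linearEquiv ℂ ℂ (fun _ : TSite d m => c₁)).symm.toLinearMap ∘ₗ QprimeW L m φ U (c₀ := c₀))) ψ⟫_ℂ)
    (s : SiteL2K ℂ d (fineP L m) c₀ W) :
    ‖covDerivL2K ℂ c₀ ((η : ℂ))⁻¹ (adTransportW φ U) (s - RofU L m φ η U (c₀ := c₀) s)‖ ≤ CE * Real.sqrt CE * CQ ^ 2 / κ₁ * ‖s‖ := by
  rw [one_sub_RofU_apply_eq L m φ c₀ η U c₁ a' hRS hpos']
  simp only [LinearMap.comp_apply]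
  have h4 := hE s
  have h3 := (hQ (GpOfU L m φ η U a' (c₁ := c₁) hpos' s)).trans (mul_le_mul_of_nonneg_left h4 hCQ)
  have h2 := (norm_QGGQinv_le L m φ c₀ η U c₁ a' hRS hpos' hκ₁ hκ _).trans (mul_le_mul_of_nonneg_left h3 (inv_nonneg.2 hκ₁.le))
  have h1 := (norm_adjoint_Qt_le L m φ c₀ U c₁ hCQ hQ _).trans (mul_le_mul_of_nonneg_left h2 hCQ)
  have h0 := (norm_covDerivL2K_GpOfU_le L m φ c₀ η U c₁ a' hRS hpos' ha' hCE hE _).trans (mul_le_mul_of_nonneg_left h1 (Real.sqrt_nonneg _))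
  refine h0.trans (le_of_eq ?_)
  field_simp

end Literature.MathematicalPhysics.QuantumFieldTheory.Balaban1983to89.B9Eq325ProjectionDivergenceEnergyBound

end
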